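import Literature.AlgebraicGeometry.Resolution.SharpMonoidEmbedding
import Mathlib.RingTheory.AdicCompletion.Noetherian
import HarnessLib

/-!
# Log regular local rings are integral domains (Kato 1994, Thm. (4.1), domain part)

`Literature/AlgebraicGeometry/Resolution/LogRegularDomain.lean`. K. Kato, *Toric singularities*,
Amer. J. Math. 116 (1994), Thm. (4.1): "if `(X, M)` is log regular then `X` is Cohen–Macaulay and
normal" — in particular the local rings are domains. Kato's proof of the domain/normality part is
via the structure theorem (3.2): `𝒪̂_{X,x} ≅ R[[P]][[T]]/(θ)` is an integral domain (Lemmas (3.4),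
(3.5)), and `𝒪_{X,x} ⊆ 𝒪̂_{X,x}`. We PROVE the domain assertion in this way from the files
`LogRegularCompleteStructure`, `LogRegularAbsorbedChart`, `LogRegularDimensionBound`,
`SharpMonoidEmbedding` (normality and Cohen–Macaulayness are not treated here):

* `isDomain_of_dform` — a Noetherian local ring carrying d-form chart data
  (`𝔪 = (φ(P ∖ 0)) + (t)`, `rank P + d ≤ dim A`) is a domain;
* `isDomain_localization_of_isLogRegularAt` — **if the chart `φ : P → A` (fs) is log regular at
  `𝔭` (Kato (2.1)) then `A_𝔭` is an integral domain.**

References: [Kato1994] K. Kato, Toric singularities, Amer. J. Math. 116 (1994), Thm. (4.1), (3.2)–(3.5).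
-/

noncomputable section

open IsLocalRing MvPowerSeries Literature.RingTheory.MvPowerSeries
  Literature.RingTheory.MvPowerSeries.monoidPowerSeries
  Literature.RingTheory.CompleteLocalRings

namespace Literature.AlgebraicGeometry.Resolution

namespace LogRegularCompleteStructure

universe u

/-- `Λ⟦P⟧/(θ)` is an integral domain when `Λ` is a Noetherian local domain with `𝔪_Λ = (π)`,
`π ≠ 0`, and `θ` has constant coefficient `π` (Kato, Lemmas (3.4)–(3.5): it embeds into the regular
local ring `Λ⟦T₁,…,T_M⟧/(θ)`). [cite: Kato1994, Lemma (3.4)] -/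
theorem isDomain_quotient_span_theta {Λ : Type u} [CommRing Λ] [IsLocalRing Λ] [IsDomain Λ]
    [IsNoetherianRing Λ] {M : ℕ} {P : AddSubmonoid (Fin M →₀ ℕ)} {π : Λ} (hπ0 : π ≠ 0)
    (hmax : maximalIdeal Λ = Ideal.span {π}) (θ : monoidPowerSeries Λ P)
    (hθπ : MvPowerSeries.constantCoeff (θ : MvPowerSeries (Fin M) Λ) = π) :
    IsDomain (monoidPowerSeries Λ P ⧸ Ideal.span {θ}) := by
  classical
  have hnf : ¬IsField Λ := by
    rw [IsLocalRing.isField_iff_maximalIdeal_eq, hmax, Ideal.span_singleton_eq_bot]; exact hπ0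
  have hprinc : (maximalIdeal Λ).IsPrincipal := ⟨⟨π, hmax⟩⟩
  haveI : IsDiscreteValuationRing Λ := ((IsDiscreteValuationRing.TFAE Λ hnf).out 0 4).mpr hprinc
  haveI : IsRegularLocalRing (MvPowerSeries (Fin M) Λ) :=
    Literature.NumberTheory.GaloisRepresentations.NearlyOrdinaryPresentationCA.isRegularLocalRing_mvPowerSeries_dvr
      Λ M
  have hπm : π ∈ maximalIdeal Λ := hmax ▸ Ideal.subset_span rfl
  have hθm : (θ : MvPowerSeries (Fin M) Λ) ∈ maximalIdeal (MvPowerSeries (Fin M) Λ) := by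
    rw [mem_maximalIdeal, mem_nonunits_iff]
    intro hu
    have h := MvPowerSeries.isUnit_constantCoeff _ hu
    rw [hθπ] at h
    exact ((mem_maximalIdeal _).1 hπm) h
  have hθ2 : (θ : MvPowerSeries (Fin M) Λ) ∉ maximalIdeal (MvPowerSeries (Fin M) Λ) ^ 2 :=
    fun h => generator_not_mem_sq hπ0 hmax (hθπ ▸ constantCoeff_mem_sq_of_mem_sq h)
  haveI : IsRegularLocalRing (MvPowerSeries (Fin M) Λ ⧸
      Ideal.span {(θ : MvPowerSeries (Fin M) Λ)}) :=
    (IsRegularLocalRing.quotient_span_singleton hθm hθ2).1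
  haveI : IsDomain (MvPowerSeries (Fin M) Λ ⧸ Ideal.span {(θ : MvPowerSeries (Fin M) Λ)}) :=
    isDomain_of_isRegularLocalRing _
  have hπnzd : MvPowerSeries.constantCoeff (θ : MvPowerSeries (Fin M) Λ) ∈ nonZeroDivisors Λ := by
    rw [hθπ]; exact mem_nonZeroDivisors_of_ne_zero hπ0
  have hle : Ideal.span {θ} ≤ (Ideal.span {(θ : MvPowerSeries (Fin M) Λ)}).comap
      (monoidPowerSeries Λ P).val.toRingHom := by
    rw [Ideal.span_le, Set.singleton_subset_iff]
    exact Ideal.mem_comap.2 (Ideal.subset_span rfl)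
  exact Function.Injective.isDomain _ (quotientMap_injective θ hπnzd hle)

variable {A : Type u} [CommRing A] [IsLocalRing A] [IsNoetherianRing A] {M d : ℕ}
  {P : AddSubmonoid (Fin M →₀ ℕ)} {φ : (Fin M →₀ ℕ) → A}

/-- **`Â` is a domain** for a Noetherian local ring with
d = 0 chart data (`𝔪 = (φ(P ∖ 0))`, `dim A = rank P`), by `Â ≅ Λ⟦P⟧/(θ)` (or `≅ K⟦P⟧`).
[cite: Kato1994, Thm. (4.1)] -/
theorem isDomain_adicCompletion_of_dform0 (hP : P.FG) (hφ0 : φ 0 = 1)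
    (hφadd : ∀ a ∈ P, ∀ b ∈ P, φ (a + b) = φ a * φ b)
    (hφm : ∀ p ∈ P, p ≠ 0 → φ p ∈ maximalIdeal A)
    (hgen : maximalIdeal A ≤ Ideal.span (φ '' {p | p ∈ P ∧ p ≠ 0}))
    (hdim : ringKrullDim A = rank P) :
    IsDomain (AdicCompletion (maximalIdeal A) A) := by
  classical
  haveI : IsNoetherianRing (AdicCompletion (maximalIdeal A) A) :=
    isNoetherianRing_adicCompletion_maximalIdeal A
  -- the chart of `Â`
  let φh : (Fin M →₀ ℕ) → AdicCompletion (maximalIdeal A) A := fun p => algebraMap A _ (φ p)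
  have hφh0 : φh 0 = 1 := by simp only [φh, hφ0, map_one]
  have hφhadd : ∀ a ∈ P, ∀ b ∈ P, φh (a + b) = φh a * φh b := by
    intro a ha b hb; simp only [φh, hφadd a ha b hb, map_mul]
  have hφhm : ∀ p ∈ P, p ≠ 0 → φh p ∈ maximalIdeal (AdicCompletion (maximalIdeal A) A) := by
    intro p hp hp0
    rw [AdicCompletion.maximalIdeal_eq_map]
    exact Ideal.mem_map_of_mem _ (hφm p hp hp0)
  have hgenh : maximalIdeal (AdicCompletion (maximalIdeal A) A) ≤
      Ideal.span (φh '' {p | p ∈ P ∧ p ≠ 0}) := by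
    rw [AdicCompletion.maximalIdeal_eq_map]
    refine (Ideal.map_mono hgen).trans ?_
    rw [Ideal.map_span, ← Set.image_comp]
    rfl
  have hdimh : ringKrullDim (AdicCompletion (maximalIdeal A) A) = rank P := by
    rw [ringKrullDim_adicCompletion A, hdim]
  obtain ⟨p, hp⟩ := CharP.exists (ResidueField (AdicCompletion (maximalIdeal A) A))
  rcases CharP.char_is_prime_or_zero (ResidueField (AdicCompletion (maximalIdeal A) A)) p with
    hprime | rfl
  · haveI : Fact p.Prime := ⟨hprime⟩
    obtain ⟨R, _, _, _, hRN, hRc, hmax, hp0, j, hres⟩ :=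
      exists_cohenDVR_ringHom (AdicCompletion (maximalIdeal A) A) p
    haveI := hRN
    haveI := hRc
    have hpA : (p : AdicCompletion (maximalIdeal A) A) ∈
        maximalIdeal (AdicCompletion (maximalIdeal A) A) := by
      rw [← residue_eq_zero_iff, map_natCast]; exact CharP.cast_eq_zero _ p
    haveI : IsLocalHom j := by
      refine ⟨fun r hr => ?_⟩
      by_contra hrn
      have hrm : r ∈ maximalIdeal R := (mem_maximalIdeal _).2 (mem_nonunits_iff.2 hrn)
      rw [hmax, Ideal.mem_span_singleton] at hrm
      obtain ⟨s, rfl⟩ := hrm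
      rw [map_mul, map_natCast] at hr
      exact ((mem_maximalIdeal _).1 (Ideal.mul_mem_right _ _ hpA)) hr
    obtain ⟨ψ, hψsurj, hψmon, hψC⟩ := exists_lift_surjective j hres hP φh hφh0 hφhadd hφhm hgenh
    have hjp : j (p : R) ∈ maximalIdeal _ := by rw [map_natCast]; exact hpA
    obtain ⟨θ, hθ, hθπ⟩ := exists_theta ψ hψsurj j hψC φh hψmon hgenh (p : R) hjp
    have hker := ker_eq_span_theta hp0 hmax hP ψ hψsurj hdimh θ hθ hθπ
    haveI := isDomain_quotient_span_theta hp0 hmax θ hθπ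
    have e : (monoidPowerSeries R P ⧸ RingHom.ker ψ) ≃+* AdicCompletion (maximalIdeal A) A :=
      RingHom.quotientKerEquivOfSurjective hψsurj
    have e' : (monoidPowerSeries R P ⧸ Ideal.span {θ}) ≃+* AdicCompletion (maximalIdeal A) A :=
      (Ideal.quotEquivOfEq hker.symm).trans e
    exact e'.symm.injective.isDomain e'.symm.toRingHom
  · haveI : CharZero (ResidueField (AdicCompletion (maximalIdeal A) A)) := CharP.charP_to_charZero _
    obtain ⟨σ, hσ⟩ := exists_coefficientField_of_charZero (AdicCompletion (maximalIdeal A) A)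
    have hbot : maximalIdeal (ResidueField (AdicCompletion (maximalIdeal A) A)) = ⊥ :=
      (IsLocalRing.isField_iff_maximalIdeal_eq).1 (Field.toIsField _)
    haveI : IsAdicComplete (maximalIdeal (ResidueField (AdicCompletion (maximalIdeal A) A)))
        (ResidueField (AdicCompletion (maximalIdeal A) A)) := by rw [hbot]; infer_instance
    haveI : IsLocalHom σ := by
      refine ⟨fun x hx => ?_⟩
      by_contra hxn
      have hx0 : x = 0 := by by_contra h; exact hxn (Ne.isUnit h)
      rw [hx0, map_zero] at hx
      exact not_isUnit_zero hx
    have hres : ∀ a : AdicCompletion (maximalIdeal A) A, ∃ l, a - σ l ∈ maximalIdeal _ :=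
      fun a => ⟨residue _ a, by rw [← residue_eq_zero_iff, map_sub, hσ, sub_self]⟩
    obtain ⟨ψ, hψsurj, -, -⟩ := exists_lift_surjective σ hres hP φh hφh0 hφhadd hφhm hgenh
    have hker := ker_eq_bot_of_field hP ψ hψsurj hdimh
    haveI : IsDomain (MvPowerSeries (Fin M) (ResidueField (AdicCompletion (maximalIdeal A) A))) :=
      NoZeroDivisors.to_isDomain _
    haveI : IsDomain (monoidPowerSeries (ResidueField (AdicCompletion (maximalIdeal A) A)) P) :=
      Function.Injective.isDomain (monoidPowerSeries _ P).val.toRingHom Subtype.val_injective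
    have hinj : Function.Injective ψ := by
      rw [RingHom.injective_iff_ker_eq_bot]; exact hker
    let e := RingEquiv.ofBijective ψ ⟨hinj, hψsurj⟩
    exact e.symm.injective.isDomain e.symm.toRingHom

/-- **Log regular local rings are domains (d-form).** A Noetherian local ring `A` with chart data
`φ : P → A`, parameters `t₁..t_d` with `𝔪_A = (φ(P ∖ 0)) + (t)` and `rank P + d ≤ dim A` is an
integral domain (`A ⊆ Â ≅ Λ⟦P × ℕ^d⟧/(θ)`). [cite: Kato1994, Thm. (4.1)] -/
theorem isDomain_of_dform {t : Fin d → A} (hP : P.FG) (hφ0 : φ 0 = 1)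
    (hφadd : ∀ a ∈ P, ∀ b ∈ P, φ (a + b) = φ a * φ b)
    (hφm : ∀ p ∈ P, p ≠ 0 → φ p ∈ maximalIdeal A) (ht : ∀ k, t k ∈ maximalIdeal A)
    (hgen : maximalIdeal A ≤ Ideal.span (φ '' {p | p ∈ P ∧ p ≠ 0}) ⊔ Ideal.span (Set.range t))
    (hdim : ((rank P + d : ℕ) : WithBot ℕ∞) ≤ ringKrullDim A) : IsDomain A := by
  have hdim' : ringKrullDim A = rank (absorbMonoid P d) := by
    rw [rank_absorbMonoid]
    exact le_antisymm (ringKrullDim_le_rank_add hP hφ0 hφadd hφm ht hgen) hdim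
  haveI := isDomain_adicCompletion_of_dform0 (absorbMonoid_fg hP) (absorbChart_zero hφ0 t)
    (absorbChart_add hφadd t) (absorbChart_mem_maximalIdeal hφm ht)
    (maximalIdeal_le_span_absorbChart hφ0 hgen) hdim'
  have hinj : Function.Injective (algebraMap A (AdicCompletion (maximalIdeal A) A)) :=
    AdicCompletion.of_injective (maximalIdeal A) A
  exact hinj.isDomain (algebraMap A (AdicCompletion (maximalIdeal A) A))

end LogRegularCompleteStructure

namespace LogChart

universe v

/-- **Kato 1994, Thm. (4.1) (domain part): the local rings of a log regular scheme are integral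
domains.** For a chart `φ : P → A` by a finitely generated saturated `P ⊆ ℤⁿ`, log regular at
the prime `𝔭`, the local ring `A_𝔭` is a domain. [cite: Kato1994, Thm. (4.1)] -/
theorem isDomain_localization_of_isLogRegularAt {A : Type v} [CommRing A] [IsNoetherianRing A]
    {n : ℕ} {P : AddSubmonoid (Fin n → ℤ)} (hP : P.FG)
    (hsat : ∀ (v : Fin n → ℤ) (k : ℕ), 0 < k → k • v ∈ P → v ∈ P)
    {φ : Multiplicative P →* A} {𝔭 : Ideal A} [𝔭.IsPrime] (hreg : IsLogRegularAt P φ 𝔭) :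
    IsDomain (Localization.AtPrime 𝔭) := by
  obtain ⟨e, he, π, d, t, hD, -⟩ := exists_dformData_of_isLogRegularAt'' hP hsat hreg
  exact LogRegularCompleteStructure.isDomain_of_dform hD.fg hD.map_zero hD.map_add
    hD.mem_maximalIdeal hD.param_mem hD.gen hD.rank_le

end LogChart

end Literature.AlgebraicGeometry.Resolution
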